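import Literature.Analysis.FluidPDE.TaoCascadeModeDuhamel
import Literature.Analysis.FluidPDE.TaoCascadeLowModes
import HarnessLib

/-!
# Tao's averaged Navier–Stokes blow-up: proof of Lemma 4.1 (equations of motion)

T. Tao, *Finite time blowup for an averaged three-dimensional Navier–Stokes equation*,
J. Amer. Math. Soc. **29** (2016), 601–674 = arXiv:1402.0290v3 (held as `paper:arxiv-1402.0290`),
§4, **Lemma 4.1**, pp. 21–23. This file gives a **second, independent proof of the named fact**
`Literature.Analysis.FluidPDE.Tao2016.equationsOfMotion` (`TaoCascadeMotion.lean`):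
`theorem equationsOfMotion_of_bandDuhamel : equationsOfMotion`. (The fact was first discharged by
`equationsOfMotion_holds` in `TaoCascadeEquationsOfMotion.lean`, via scalar Fourier-side Duhamel
formulas; the present proof goes through the `L²`-valued band heat group and needs neither the
cancellation (4.3) for (4.13) nor infinite sums, with implied constants depending on `ε₀` only.)

Proof, following the source (p. 22–23) over the in-tree `L²` setting:

* the projected Duhamel formula holds in `L²`, `u_{i,n}(t) = V_{i,n}(t)`
  (`TaoCascadeModeDuhamel.lean`), with `V_{i,n}` the Duhamel element of the norm-differentiable band
  heat group (`TaoBandHeatGroup.lean`), so `X_{i,n} = Re ⟪ψ_{i,n}, V⟫` and `E_{i,n} = ½‖V‖²` are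
  `C¹` with `∂ₜX = Re⟪ψ, L V⟫ + G`, `∂ₜE = Re⟪V, L V⟫ + G X` (`hasDerivAt_modeXc`, `hasDerivAt_modeEc`);
* (4.10): `|Re ⟪ψ_{i,n}, L V⟫| ≤ ‖L‖ ‖V‖ ≤ 4π²ρₙ² ‖V‖`, `ρₙ = (1+ε₀)ⁿ(1+ε₀/2)` (the band Laplacian is
  bounded), giving `K₁ = 4√2 π² (1+ε₀/2)²`; (4.11): `Re ⟪V, L V⟫ ≤ 0`;
* (4.12): `Φ = E - ½X² - 2·4π²ρₙ² ∫₀ᵗ E` has `Φ' ≤ 0`, `Φ(0) = 0`, giving `K₂ = 8π²(1+ε₀/2)²`;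
* (4.8)–(4.9): `u(0) = u₀` in `L²` and the projections of the datum;
* (4.6)–(4.7): the `C⁰_t H¹⁰_x` bound (`TaoMildSolutionBounds.lean`);
* (4.13): the ODE-layer Gronwall lemma `TaoCascade.lowMode_energy_eq_zero` (`TaoCascadeLowModes.lean`).

The implied constants `K₁, K₂` depend on `ε₀` only (not on the data, `α`, `n₀` or `u`). The
hypotheses (4.2)/(4.3) on `α` of the printed lemma are not needed.

## References

* T. Tao, J. Amer. Math. Soc. 29 (2016), 601–674, arXiv:1402.0290v3, §4 Lemma 4.1 (4.5)–(4.15),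
  pp. 21–23. Key `Tao2016AveragedNS`.
-/

noncomputable section

open MeasureTheory Set Filter FourierTransform Metric
open scoped ENNReal NNReal ComplexConjugate InnerProductSpace Topology

namespace Literature.Analysis.FluidPDE.Tao2016

variable {ε₀ : ℝ} {m : ℕ}

/-! ### Constants and exponents -/

/-- `0 < 1 + ε₀` for `ε₀ > 0`. [folklore] -/
theorem one_add_pos_of_pos (hε₀ : 0 < ε₀) : 0 < 1 + ε₀ := by linarith

/-- `(1+ε₀)^{2n}` as a real power: `(1+ε₀)^{(2:ℝ) n} = ((1+ε₀)ⁿ)²`. [folklore] -/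
theorem rpow_two_mul_intCast (hε₀ : 0 < ε₀) (n : ℤ) : (1 + ε₀) ^ ((2 : ℝ) * n) = ((1 + ε₀) ^ n) ^ 2 := by
  rw [mul_comm, Real.rpow_mul (by linarith), Real.rpow_intCast, Real.rpow_two]

/-- `(1+ε₀)^{10n}` as a real power: `(1+ε₀)^{(10:ℝ) n} = ((1+ε₀)ⁿ)¹⁰`. [folklore] -/
theorem rpow_ten_mul_intCast (hε₀ : 0 < ε₀) (n : ℤ) : (1 + ε₀) ^ ((10 : ℝ) * n) = ((1 + ε₀) ^ n) ^ 10 := by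
  rw [mul_comm, Real.rpow_mul (by linarith), Real.rpow_intCast]
  norm_cast

/-- The bound `4π²ρₙ²` of the band Laplacian of the mode `n` equals `4π²(1+ε₀/2)² (1+ε₀)^{2n}`. [folklore] -/
theorem laplaceBound_eq (hε₀ : 0 < ε₀) (n : ℤ) :
    4 * Real.pi ^ 2 * ((1 + ε₀) ^ n * (1 + ε₀ / 2)) ^ 2 =
      (4 * Real.pi ^ 2 * (1 + ε₀ / 2) ^ 2) * (1 + ε₀) ^ ((2 : ℝ) * n) := by
  rw [rpow_two_mul_intCast hε₀]
  ring

/-- `√(a²/2) = a/√2` for `a ≥ 0`. [folklore] -/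
theorem sqrt_sq_div_two {a : ℝ} (ha : 0 ≤ a) : Real.sqrt (a ^ 2 / 2) = a / Real.sqrt 2 := by
  rw [Real.sqrt_div (sq_nonneg a), Real.sqrt_sq ha]

/-- `√2 · √(a²/2) = a` for `a ≥ 0`. [folklore] -/
theorem sqrt_two_mul_sqrt_sq_div_two {a : ℝ} (ha : 0 ≤ a) : Real.sqrt 2 * Real.sqrt (a ^ 2 / 2) = a := by
  rw [sqrt_sq_div_two ha, mul_div_cancel₀ _ (Real.sqrt_ne_zero'.2 (by norm_num))]

/-! ### The mode calculus of a mild solution -/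

section Mode

variable (hε₀ : 0 < ε₀) (𝒟 : CascadeWaveletData ε₀ m) (α : Fin m → Fin m → Fin m → ℤ × ℤ × ℤ → ℝ)
  (i₀ : Fin m) (n₀ : ℤ) (u : ℝ → L2C)

include hε₀

/-- The Duhamel element `V_{i,n}(t)` of the mode, for `ε₀ > 0`. [cite: Tao2016AveragedNS, §4 (4.14)] -/
def modeV (i : Fin m) (n : ℤ) (t : ℝ) : L2C :=
  modeDuhamel (one_add_pos_of_pos hε₀) 𝒟 α i₀ n₀ u i n t

/-- The complex coefficient `⟪ψ_{i,n}, V_{i,n}(t)⟫` (whose real part is `X_{i,n}(t)` for `t ≥ 0`). [cite: Tao2016AveragedNS, Lemma 4.1] -/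
def modeXc (i : Fin m) (n : ℤ) (t : ℝ) : ℂ :=
  ⟪cascadeWavelet ε₀ (𝒟.ψ i) n, modeV hε₀ 𝒟 α i₀ n₀ u i n t⟫_ℂ

/-- The energy `½ ‖V_{i,n}(t)‖²` (equal to `E_{i,n}(t)` for `t ≥ 0`). [cite: Tao2016AveragedNS, Lemma 4.1 (4.5)] -/
def modeEc (i : Fin m) (n : ℤ) (t : ℝ) : ℝ :=
  ‖modeV hε₀ 𝒟 α i₀ n₀ u i n t‖ ^ 2 / 2

/-- The band Laplacian `L_{i,n}` of the mode. [cite: Tao2016AveragedNS, §4 (4.15)] -/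
def modeL (i : Fin m) (n : ℤ) : L2C →L[ℂ] L2C :=
  bandLaplace (measurableSet_freqRegion 𝒟 i n) (freqRegion_subset_closedBall (one_add_pos_of_pos hε₀) 𝒟 i n)

/-- The derivative of the energy along the mode flow: `Re ⟪V, L V⟫ + Re G · Re ⟪ψ, V⟫`. [cite: Tao2016AveragedNS, §4 (4.11)] -/
def modeEc' (i : Fin m) (n : ℤ) (t : ℝ) : ℝ :=
  (⟪modeV hε₀ 𝒟 α i₀ n₀ u i n t, modeL hε₀ 𝒟 i n (modeV hε₀ 𝒟 α i₀ n₀ u i n t)⟫_ℂ).re +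
    (driveC 𝒟 α u i n t).re * (modeXc hε₀ 𝒟 α i₀ n₀ u i n t).re

/-- `Re ⟪V, L V⟫ ≤ 0` (Tao: "noting that `⟨Δ u_{i,n}, u_{i,n}⟩ ≤ 0`"). [cite: Tao2016AveragedNS, §4 (4.11)] -/
theorem re_inner_modeL_modeV_nonpos (i : Fin m) (n : ℤ) (t : ℝ) :
    (⟪modeV hε₀ 𝒟 α i₀ n₀ u i n t, modeL hε₀ 𝒟 i n (modeV hε₀ 𝒟 α i₀ n₀ u i n t)⟫_ℂ).re ≤ 0 :=
  (inner_bandLaplace_self _ _ _).1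

/-- `|Re ⟪ψ, V⟫| ≤ ‖V‖`. [folklore] -/
theorem abs_re_modeXc_le (i : Fin m) (n : ℤ) (t : ℝ) :
    |(modeXc hε₀ 𝒟 α i₀ n₀ u i n t).re| ≤ ‖modeV hε₀ 𝒟 α i₀ n₀ u i n t‖ := by
  refine (Complex.abs_re_le_norm _).trans ?_
  refine (norm_inner_le_norm _ _).trans ?_
  rw [𝒟.norm_cascadeWavelet (one_add_pos_of_pos hε₀), one_mul]

variable {𝒟 α i₀ n₀ u}
variable (hu : IsMildSolutionFor (cascadeOperatorForm ε₀ 𝒟.ψ α) (cascadeWavelet ε₀ (𝒟.ψ i₀) n₀) (Ici 0) u)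

/-- `ψ_{i,n}` is fixed by the projection of its own mode. [folklore] -/
theorem bandProj_cascadeWavelet (i : Fin m) (n : ℤ) :
    bandProj (measurableSet_freqRegion 𝒟 i n) (cascadeWavelet ε₀ (𝒟.ψ i) n) = cascadeWavelet ε₀ (𝒟.ψ i) n :=
  (cascadeWavelet_isBandLimited (one_add_pos_of_pos hε₀) 𝒟 i n).bandProj_eq _

/-- `⟪ψ_{i,n}, ψ_{i,n}⟫ = 1`. [cite: Tao2016AveragedNS, §4 p. 21] -/
theorem inner_cascadeWavelet_self (i : Fin m) (n : ℤ) :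
    ⟪cascadeWavelet ε₀ (𝒟.ψ i) n, cascadeWavelet ε₀ (𝒟.ψ i) n⟫_ℂ = 1 := by
  rw [inner_self_eq_norm_sq_to_K, 𝒟.norm_cascadeWavelet (one_add_pos_of_pos hε₀)]
  simp

/-- `‖L_{i,n}‖ ≤ 4π²ρₙ²`. [folklore] -/
theorem norm_modeL_le (i : Fin m) (n : ℤ) :
    ‖modeL hε₀ 𝒟 i n‖ ≤ 4 * Real.pi ^ 2 * ((1 + ε₀) ^ n * (1 + ε₀ / 2)) ^ 2 :=
  norm_bandLaplace_le _ _

/-- `|⟪ψ_{i,n}, L V⟫| ≤ 4π²ρₙ² ‖V‖` (Tao p. 22: `⟨Δ u_{i,n}, ψ_{i,n}⟩ = O((1+ε₀)^{2n} E^{1/2})`). [cite: Tao2016AveragedNS, §4 (4.10)] -/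
theorem norm_inner_modeL_le (i : Fin m) (n : ℤ) (v : L2C) :
    ‖⟪cascadeWavelet ε₀ (𝒟.ψ i) n, modeL hε₀ 𝒟 i n v⟫_ℂ‖ ≤
      4 * Real.pi ^ 2 * ((1 + ε₀) ^ n * (1 + ε₀ / 2)) ^ 2 * ‖v‖ := by
  calc ‖⟪cascadeWavelet ε₀ (𝒟.ψ i) n, modeL hε₀ 𝒟 i n v⟫_ℂ‖
      ≤ ‖cascadeWavelet ε₀ (𝒟.ψ i) n‖ * ‖modeL hε₀ 𝒟 i n v‖ := norm_inner_le_norm _ _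
    _ ≤ 1 * (‖modeL hε₀ 𝒟 i n‖ * ‖v‖) := by
        rw [𝒟.norm_cascadeWavelet (one_add_pos_of_pos hε₀)]
        exact mul_le_mul_of_nonneg_left (ContinuousLinearMap.le_opNorm _ _) zero_le_one
    _ ≤ 1 * (4 * Real.pi ^ 2 * ((1 + ε₀) ^ n * (1 + ε₀ / 2)) ^ 2 * ‖v‖) := by
        gcongr
        exact norm_modeL_le hε₀ i n
    _ = _ := one_mul _

include hu

omit hε₀ in
/-- The drive of a mild solution is continuous. [folklore] -/
theorem IsMildSolutionFor.continuous_driveC (i : Fin m) (n : ℤ) : Continuous (driveC 𝒟 α u i n) :=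
  Tao2016.continuous_driveC hu.continuousOn_Ici i n

/-- **`∂ₜ V = L V + G ψ` for the mode of a mild solution.** [cite: Tao2016AveragedNS, §4 (4.15)] -/
theorem IsMildSolutionFor.hasDerivAt_modeV (i : Fin m) (n : ℤ) (t : ℝ) :
    HasDerivAt (modeV hε₀ 𝒟 α i₀ n₀ u i n)
      (modeL hε₀ 𝒟 i n (modeV hε₀ 𝒟 α i₀ n₀ u i n t) + driveC 𝒟 α u i n t • cascadeWavelet ε₀ (𝒟.ψ i) n) t := by
  have h := hasDerivAt_duhamelV (measurableSet_freqRegion 𝒟 i n)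
    (freqRegion_subset_closedBall (one_add_pos_of_pos hε₀) 𝒟 i n) (hu.continuous_driveC i n)
    (cascadeWavelet ε₀ (𝒟.ψ i₀) n₀) (cascadeWavelet ε₀ (𝒟.ψ i) n) t
  rw [bandProj_cascadeWavelet hε₀] at h
  exact h

/-- `V` is continuous. [folklore] -/
theorem IsMildSolutionFor.continuous_modeV (i : Fin m) (n : ℤ) : Continuous (modeV hε₀ 𝒟 α i₀ n₀ u i n) :=
  continuous_iff_continuousAt.2 fun t => (hu.hasDerivAt_modeV hε₀ i n t).continuousAt

/-- **`∂ₜ ⟪ψ, V⟫ = ⟪ψ, L V⟫ + G`** (Tao: "if we take inner products of (4.15) with `ψ_{i,n}`"). [cite: Tao2016AveragedNS, §4 (4.10)] -/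
theorem IsMildSolutionFor.hasDerivAt_modeXc (i : Fin m) (n : ℤ) (t : ℝ) :
    HasDerivAt (modeXc hε₀ 𝒟 α i₀ n₀ u i n)
      (⟪cascadeWavelet ε₀ (𝒟.ψ i) n, modeL hε₀ 𝒟 i n (modeV hε₀ 𝒟 α i₀ n₀ u i n t)⟫_ℂ + driveC 𝒟 α u i n t) t := by
  have h := (hasDerivAt_const t (cascadeWavelet ε₀ (𝒟.ψ i) n)).inner ℂ (hu.hasDerivAt_modeV hε₀ i n t)
  rw [inner_zero_left, add_zero, inner_add_right, inner_smul_right, inner_cascadeWavelet_self hε₀, mul_one] at h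
  exact h

/-- **`∂ₜ (½‖V‖²) = Re⟪V, L V⟫ + Re G · Re⟪ψ, V⟫`** (Tao: "taking inner products of (4.15) with
`u_{i,n}`"). [cite: Tao2016AveragedNS, §4 (4.11)] -/
theorem IsMildSolutionFor.hasDerivAt_modeEc (i : Fin m) (n : ℤ) (t : ℝ) :
    HasDerivAt (modeEc hε₀ 𝒟 α i₀ n₀ u i n) (modeEc' hε₀ 𝒟 α i₀ n₀ u i n t) t := by
  set V := modeV hε₀ 𝒟 α i₀ n₀ u i n with hV
  set D := modeL hε₀ 𝒟 i n (V t) + driveC 𝒟 α u i n t • cascadeWavelet ε₀ (𝒟.ψ i) n with hD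
  have hd : HasDerivAt V D t := hu.hasDerivAt_modeV hε₀ i n t
  have hi := hd.inner ℂ hd
  have hre : HasDerivAt (fun s => (⟪V s, V s⟫_ℂ).re) (Complex.reCLM (⟪V t, D⟫_ℂ + ⟪D, V t⟫_ℂ)) t :=
    Complex.reCLM.hasFDerivAt.comp_hasDerivAt t hi
  have hfun : modeEc hε₀ 𝒟 α i₀ n₀ u i n = fun s => (⟪V s, V s⟫_ℂ).re / 2 := by
    funext s
    rw [modeEc, ← hV]
    exact congrArg (· / 2) (inner_self_eq_norm_sq (𝕜 := ℂ) (V s)).symm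
  rw [hfun]
  refine (hre.div_const 2).congr_deriv ?_
  have hreal : (driveC 𝒟 α u i n t).im = 0 := driveC_im hu.isReal_of_nonneg i n t
  have hconj : ⟪V t, cascadeWavelet ε₀ (𝒟.ψ i) n⟫_ℂ = conj (modeXc hε₀ 𝒟 α i₀ n₀ u i n t) := by
    rw [modeXc, inner_conj_symm]
  rw [Complex.reCLM_apply, ← inner_conj_symm D (V t), Complex.add_re, Complex.conj_re, hD,
    inner_add_right, inner_smul_right, Complex.add_re, hconj, Complex.mul_re, Complex.conj_re,
    Complex.conj_im, hreal, zero_mul, sub_zero, modeEc']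
  ring

/-! ### Identification with `X_{i,n}`, `E_{i,n}` on `[0,∞)` -/

/-- `X_{i,n}(t) = Re ⟪ψ, V(t)⟫` for `t ≥ 0`. [cite: Tao2016AveragedNS, Lemma 4.1] -/
theorem IsMildSolutionFor.modeCoeff_eq_re {i : Fin m} {n : ℤ} {t : ℝ} (ht : 0 ≤ t) :
    modeCoeff 𝒟 u i n t = (modeXc hε₀ 𝒟 α i₀ n₀ u i n t).re :=
  hu.modeCoeff_eq (one_add_pos_of_pos hε₀) hε₀ i n ht

/-- `E_{i,n}(t) = ½‖V(t)‖²` for `t ≥ 0`. [cite: Tao2016AveragedNS, Lemma 4.1 (4.5)] -/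
theorem IsMildSolutionFor.modeEnergy_eq_Ec {i : Fin m} {n : ℤ} {t : ℝ} (ht : 0 ≤ t) :
    modeEnergy 𝒟 u i n t = modeEc hε₀ 𝒟 α i₀ n₀ u i n t :=
  hu.modeEnergy_eq (one_add_pos_of_pos hε₀) hε₀ i n ht

omit hε₀ in
/-- `Re G(t) = quadTerm(X)(t)` for `t ≥ 0`. [cite: Tao2016AveragedNS, §4 (4.10)] -/
theorem IsMildSolutionFor.re_driveC_eq {i : Fin m} {n : ℤ} {t : ℝ} (ht : 0 ≤ t) :
    (driveC 𝒟 α u i n t).re = TaoCascade.quadTerm ε₀ α (modeCoeff 𝒟 u) i n t := by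
  rw [driveC_eq_ofReal_of_nonneg hu.isReal_of_nonneg i n ht, Complex.ofReal_re]

/-- **`X_{i,n}` is `C¹` on `[0,∞)`** (Tao: "which implies that the `X_{i,n}` are continuously
differentiable"). [cite: Tao2016AveragedNS, Lemma 4.1] -/
theorem IsMildSolutionFor.contDiffOn_modeCoeff (i : Fin m) (n : ℤ) : ContDiffOn ℝ 1 (modeCoeff 𝒟 u i n) (Ici 0) := by
  have hXc : ContDiff ℝ 1 (modeXc hε₀ 𝒟 α i₀ n₀ u i n) := by
    rw [contDiff_one_iff_deriv]
    refine ⟨fun t => (hu.hasDerivAt_modeXc hε₀ i n t).differentiableAt, ?_⟩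
    have hd : deriv (modeXc hε₀ 𝒟 α i₀ n₀ u i n) = fun t =>
        ⟪cascadeWavelet ε₀ (𝒟.ψ i) n, modeL hε₀ 𝒟 i n (modeV hε₀ 𝒟 α i₀ n₀ u i n t)⟫_ℂ + driveC 𝒟 α u i n t :=
      funext fun t => (hu.hasDerivAt_modeXc hε₀ i n t).deriv
    rw [hd]
    exact (continuous_const.inner ((modeL hε₀ 𝒟 i n).continuous.comp (hu.continuous_modeV hε₀ i n))).add
      (hu.continuous_driveC i n)
  refine ((Complex.reCLM.contDiff.comp hXc).contDiffOn (s := Ici 0)).congr fun t ht => ?_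
  exact hu.modeCoeff_eq_re hε₀ ht

/-- **`E_{i,n}` is `C¹` on `[0,∞)`.** [cite: Tao2016AveragedNS, Lemma 4.1] -/
theorem IsMildSolutionFor.contDiffOn_modeEnergy (i : Fin m) (n : ℤ) : ContDiffOn ℝ 1 (modeEnergy 𝒟 u i n) (Ici 0) := by
  have hEc : ContDiff ℝ 1 (modeEc hε₀ 𝒟 α i₀ n₀ u i n) := by
    rw [contDiff_one_iff_deriv]
    refine ⟨fun t => (hu.hasDerivAt_modeEc hε₀ i n t).differentiableAt, ?_⟩
    have hd : deriv (modeEc hε₀ 𝒟 α i₀ n₀ u i n) = modeEc' hε₀ 𝒟 α i₀ n₀ u i n :=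
      funext fun t => (hu.hasDerivAt_modeEc hε₀ i n t).deriv
    rw [hd]
    unfold modeEc' modeXc
    have hV := hu.continuous_modeV hε₀ i n
    refine (Complex.continuous_re.comp (hV.inner ((modeL hε₀ 𝒟 i n).continuous.comp hV))).add ?_
    exact (Complex.continuous_re.comp (hu.continuous_driveC i n)).mul
      (Complex.continuous_re.comp (continuous_const.inner hV))
  refine (hEc.contDiffOn (s := Ici 0)).congr fun t ht => ?_
  exact hu.modeEnergy_eq_Ec hε₀ ht

/-- The right derivative of `X_{i,n}` within `[0,∞)`. [cite: Tao2016AveragedNS, §4 (4.10)] -/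
theorem IsMildSolutionFor.hasDerivWithinAt_modeCoeff (i : Fin m) (n : ℤ) {t : ℝ} (ht : 0 ≤ t) :
    HasDerivWithinAt (modeCoeff 𝒟 u i n)
      ((⟪cascadeWavelet ε₀ (𝒟.ψ i) n, modeL hε₀ 𝒟 i n (modeV hε₀ 𝒟 α i₀ n₀ u i n t)⟫_ℂ).re +
        TaoCascade.quadTerm ε₀ α (modeCoeff 𝒟 u) i n t) (Ici 0) t := by
  have h := (Complex.reCLM.hasFDerivAt.comp_hasDerivAt t (hu.hasDerivAt_modeXc hε₀ i n t)).hasDerivWithinAt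
    (s := Ici 0)
  rw [Complex.reCLM_apply, Complex.add_re, hu.re_driveC_eq ht] at h
  exact h.congr_of_mem (fun _ hs => hu.modeCoeff_eq_re hε₀ hs) ht

/-- The right derivative of `E_{i,n}` within `[0,∞)`. [cite: Tao2016AveragedNS, §4 (4.11)] -/
theorem IsMildSolutionFor.hasDerivWithinAt_modeEnergy (i : Fin m) (n : ℤ) {t : ℝ} (ht : 0 ≤ t) :
    HasDerivWithinAt (modeEnergy 𝒟 u i n) (modeEc' hε₀ 𝒟 α i₀ n₀ u i n t) (Ici 0) t :=
  ((hu.hasDerivAt_modeEc hε₀ i n t).hasDerivWithinAt (s := Ici 0)).congr_of_mem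
    (fun _ hs => hu.modeEnergy_eq_Ec hε₀ hs) ht

/-- **(4.10), the equation of motion**: for `t ≥ 0`,
`|∂ₜ X_{i,n} - quadTerm_{i,n}| ≤ K₁ (1+ε₀)^{2n} E_{i,n}^{1/2}` with `K₁ = 4√2π²(1+ε₀/2)²`. [cite: Tao2016AveragedNS, §4 (4.10)] -/
theorem IsMildSolutionFor.motion (i : Fin m) (n : ℤ) {t : ℝ} (ht : 0 ≤ t) :
    |derivWithin (modeCoeff 𝒟 u i n) (Ici 0) t - TaoCascade.quadTerm ε₀ α (modeCoeff 𝒟 u) i n t| ≤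
      (4 * Real.pi ^ 2 * (1 + ε₀ / 2) ^ 2 * Real.sqrt 2) * (1 + ε₀) ^ ((2 : ℝ) * n) *
        Real.sqrt (modeEnergy 𝒟 u i n t) := by
  rw [(hu.hasDerivWithinAt_modeCoeff hε₀ i n ht).derivWithin (uniqueDiffOn_Ici 0 t ht), add_sub_cancel_right,
    hu.modeEnergy_eq_Ec hε₀ ht, modeEc]
  calc |(⟪cascadeWavelet ε₀ (𝒟.ψ i) n, modeL hε₀ 𝒟 i n (modeV hε₀ 𝒟 α i₀ n₀ u i n t)⟫_ℂ).re|
      ≤ ‖⟪cascadeWavelet ε₀ (𝒟.ψ i) n, modeL hε₀ 𝒟 i n (modeV hε₀ 𝒟 α i₀ n₀ u i n t)⟫_ℂ‖ :=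
        Complex.abs_re_le_norm _
    _ ≤ 4 * Real.pi ^ 2 * ((1 + ε₀) ^ n * (1 + ε₀ / 2)) ^ 2 * ‖modeV hε₀ 𝒟 α i₀ n₀ u i n t‖ :=
        norm_inner_modeL_le hε₀ i n _
    _ = (4 * Real.pi ^ 2 * (1 + ε₀ / 2) ^ 2 * Real.sqrt 2) * (1 + ε₀) ^ ((2 : ℝ) * n) *
        Real.sqrt (‖modeV hε₀ 𝒟 α i₀ n₀ u i n t‖ ^ 2 / 2) := by
        rw [laplaceBound_eq hε₀]
        conv_lhs => rw [← sqrt_two_mul_sqrt_sq_div_two (norm_nonneg (modeV hε₀ 𝒟 α i₀ n₀ u i n t))]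
        ring

/-- **(4.11), the local energy inequality**: for `t ≥ 0`, `∂ₜ E_{i,n} ≤ quadTerm_{i,n} · X_{i,n}`. [cite: Tao2016AveragedNS, §4 (4.11)] -/
theorem IsMildSolutionFor.energy (i : Fin m) (n : ℤ) {t : ℝ} (ht : 0 ≤ t) :
    derivWithin (modeEnergy 𝒟 u i n) (Ici 0) t ≤
      TaoCascade.quadTerm ε₀ α (modeCoeff 𝒟 u) i n t * modeCoeff 𝒟 u i n t := by
  rw [(hu.hasDerivWithinAt_modeEnergy hε₀ i n ht).derivWithin (uniqueDiffOn_Ici 0 t ht), modeEc',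
    hu.re_driveC_eq ht, ← hu.modeCoeff_eq_re hε₀ ht]
  linarith [re_inner_modeL_modeV_nonpos hε₀ 𝒟 α i₀ n₀ u i n t]

/-- **(4.12), lower bound**: `½ X_{i,n}² ≤ E_{i,n}` for `t ≥ 0` (Cauchy–Schwarz). [cite: Tao2016AveragedNS, §4 (4.12)] -/
theorem IsMildSolutionFor.defect_lower (i : Fin m) (n : ℤ) {t : ℝ} (ht : 0 ≤ t) :
    (1 / 2) * modeCoeff 𝒟 u i n t ^ 2 ≤ modeEnergy 𝒟 u i n t := by
  rw [hu.modeCoeff_eq_re hε₀ ht, hu.modeEnergy_eq_Ec hε₀ ht, modeEc]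
  have h := abs_re_modeXc_le hε₀ 𝒟 α i₀ n₀ u i n t
  have h0 := abs_nonneg ((modeXc hε₀ 𝒟 α i₀ n₀ u i n t).re)
  nlinarith [sq_abs ((modeXc hε₀ 𝒟 α i₀ n₀ u i n t).re)]

/-! ### Initial values -/

omit hu in
/-- `V(0)` is the projection of the datum: `ψ_{i,n}` if `(i,n) = (i₀,n₀)`, else `0`. [cite: Tao2016AveragedNS, §4 (4.8)–(4.9)] -/
theorem IsMildSolutionFor.modeV_zero (i : Fin m) (n : ℤ) :
    modeV hε₀ 𝒟 α i₀ n₀ u i n 0 = if i = i₀ ∧ n = n₀ then cascadeWavelet ε₀ (𝒟.ψ i) n else 0 := by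
  rw [modeV, modeDuhamel, duhamelV_zero]
  exact modeProjection_datum hε₀ 𝒟 i i₀ n n₀

omit hu in
/-- `X_{i,n}(0)` (as `Re ⟪ψ, V(0)⟫`): `1_{(i,n)=(i₀,n₀)}`. [cite: Tao2016AveragedNS, §4 (4.9)] -/
theorem IsMildSolutionFor.modeXc_zero (i : Fin m) (n : ℤ) :
    modeXc hε₀ 𝒟 α i₀ n₀ u i n 0 = if i = i₀ ∧ n = n₀ then 1 else 0 := by
  rw [modeXc, modeV_zero hε₀]
  split_ifs
  · exact inner_cascadeWavelet_self hε₀ i n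
  · exact inner_zero_right _

omit hu in
/-- `½‖V(0)‖²`: `½ · 1_{(i,n)=(i₀,n₀)}`. [cite: Tao2016AveragedNS, §4 (4.8)] -/
theorem IsMildSolutionFor.modeEc_zero (i : Fin m) (n : ℤ) :
    modeEc hε₀ 𝒟 α i₀ n₀ u i n 0 = if i = i₀ ∧ n = n₀ then 1 / 2 else 0 := by
  rw [modeEc, modeV_zero hε₀]
  split_ifs
  · rw [𝒟.norm_cascadeWavelet (one_add_pos_of_pos hε₀)]
    norm_num
  · simp

/-- **(4.9)**: `X_{i,n}(0) = 1_{(i,n)=(i₀,n₀)}`. [cite: Tao2016AveragedNS, §4 (4.9)] -/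
theorem IsMildSolutionFor.init_X (i : Fin m) (n : ℤ) :
    modeCoeff 𝒟 u i n 0 = if i = i₀ ∧ n = n₀ then 1 else 0 := by
  rw [hu.modeCoeff_eq_re hε₀ (le_refl _), modeXc_zero hε₀]
  split_ifs <;> simp

/-- **(4.8)**: `E_{i,n}(0) = ½ X_{i,n}(0)²`. [cite: Tao2016AveragedNS, §4 (4.8)] -/
theorem IsMildSolutionFor.init_E (i : Fin m) (n : ℤ) :
    modeEnergy 𝒟 u i n 0 = (1 / 2) * modeCoeff 𝒟 u i n 0 ^ 2 := by
  rw [hu.modeEnergy_eq_Ec hε₀ (le_refl _), modeEc_zero hε₀, hu.init_X hε₀]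
  split_ifs <;> norm_num

/-! ### (4.12), upper bound -/

/-- **(4.12), upper bound**: for `t ≥ 0`,
`E_{i,n}(t) ≤ ½ X_{i,n}(t)² + K₂ (1+ε₀)^{2n} ∫₀ᵗ E_{i,n}`, `K₂ = 8π²(1+ε₀/2)²` (Tao:
"`∂ₜ(E - ½X²) ≤ O((1+ε₀)^{2n} E)` … vanishes at time zero … fundamental theorem of calculus";
here `Φ = E - ½X² - 2·4π²ρₙ² ∫₀ᵗ E` is non-increasing on `ℝ` with `Φ(0) = 0`). [cite: Tao2016AveragedNS, §4 (4.12)] -/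
theorem IsMildSolutionFor.defect_upper (i : Fin m) (n : ℤ) {t : ℝ} (ht : 0 ≤ t) :
    modeEnergy 𝒟 u i n t ≤ (1 / 2) * modeCoeff 𝒟 u i n t ^ 2 +
      (8 * Real.pi ^ 2 * (1 + ε₀ / 2) ^ 2) * (1 + ε₀) ^ ((2 : ℝ) * n) *
        ∫ s in (0 : ℝ)..t, modeEnergy 𝒟 u i n s := by
  set A : ℝ := 4 * Real.pi ^ 2 * ((1 + ε₀) ^ n * (1 + ε₀ / 2)) ^ 2 with hA
  set Ec := modeEc hε₀ 𝒟 α i₀ n₀ u i n with hEcdef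
  set Xc := modeXc hε₀ 𝒟 α i₀ n₀ u i n with hXcdef
  set V := modeV hε₀ 𝒟 α i₀ n₀ u i n with hVdef
  have hA0 : 0 ≤ A := by positivity
  have hEc_cont : Continuous Ec :=
    continuous_iff_continuousAt.2 fun s => (hu.hasDerivAt_modeEc hε₀ i n s).continuousAt
  -- the Lyapunov-type function Φ
  set Φ : ℝ → ℝ := fun s => Ec s - (1 / 2) * (Xc s).re ^ 2 - 2 * A * ∫ r in (0 : ℝ)..s, Ec r with hΦ
  have hΦd : ∀ s, HasDerivAt Φ (modeEc' hε₀ 𝒟 α i₀ n₀ u i n s -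
      (Xc s).re * ((⟪cascadeWavelet ε₀ (𝒟.ψ i) n, modeL hε₀ 𝒟 i n (V s)⟫_ℂ).re + (driveC 𝒟 α u i n s).re) -
      2 * A * Ec s) s := by
    intro s
    have h1 := hu.hasDerivAt_modeEc hε₀ i n s
    have h2 : HasDerivAt (fun r => (Xc r).re)
        ((⟪cascadeWavelet ε₀ (𝒟.ψ i) n, modeL hε₀ 𝒟 i n (V s)⟫_ℂ).re + (driveC 𝒟 α u i n s).re) s := by
      have h := Complex.reCLM.hasFDerivAt.comp_hasDerivAt s (hu.hasDerivAt_modeXc hε₀ i n s)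
      rw [Complex.reCLM_apply, Complex.add_re] at h
      exact h
    have h3 : HasDerivAt (fun r => (1 / 2) * (Xc r).re ^ 2)
        ((Xc s).re * ((⟪cascadeWavelet ε₀ (𝒟.ψ i) n, modeL hε₀ 𝒟 i n (V s)⟫_ℂ).re + (driveC 𝒟 α u i n s).re)) s := by
      have h := (h2.pow 2).const_mul (1 / 2)
      refine h.congr_deriv ?_
      ring
    have h4 : HasDerivAt (fun r => 2 * A * ∫ x in (0 : ℝ)..r, Ec x) (2 * A * Ec s) s :=
      (intervalIntegral.integral_hasDerivAt_right (hEc_cont.intervalIntegrable 0 s)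
        (hEc_cont.stronglyMeasurableAtFilter volume (𝓝 s)) hEc_cont.continuousAt).const_mul (2 * A)
    exact (h1.sub h3).sub h4
  have hΦ' : ∀ s, deriv Φ s ≤ 0 := by
    intro s
    rw [(hΦd s).deriv]
    unfold modeEc'
    have hle := re_inner_modeL_modeV_nonpos hε₀ 𝒟 α i₀ n₀ u i n s
    have hX := abs_re_modeXc_le hε₀ 𝒟 α i₀ n₀ u i n s
    have hL := norm_inner_modeL_le hε₀ (𝒟 := 𝒟) i n (V s)
    have hXL : -((Xc s).re * (⟪cascadeWavelet ε₀ (𝒟.ψ i) n, modeL hε₀ 𝒟 i n (V s)⟫_ℂ).re) ≤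
        ‖V s‖ * (A * ‖V s‖) := by
      calc -((Xc s).re * (⟪cascadeWavelet ε₀ (𝒟.ψ i) n, modeL hε₀ 𝒟 i n (V s)⟫_ℂ).re)
          ≤ |(Xc s).re * (⟪cascadeWavelet ε₀ (𝒟.ψ i) n, modeL hε₀ 𝒟 i n (V s)⟫_ℂ).re| := neg_le_abs _
        _ = |(Xc s).re| * |(⟪cascadeWavelet ε₀ (𝒟.ψ i) n, modeL hε₀ 𝒟 i n (V s)⟫_ℂ).re| := abs_mul _ _
        _ ≤ ‖V s‖ * (A * ‖V s‖) :=
            mul_le_mul hX ((Complex.abs_re_le_norm _).trans hL) (abs_nonneg _) (norm_nonneg _)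
    have hEc_eq : Ec s = ‖V s‖ ^ 2 / 2 := rfl
    change (⟪V s, modeL hε₀ 𝒟 i n (V s)⟫_ℂ).re + (driveC 𝒟 α u i n s).re * (Xc s).re -
      (Xc s).re * ((⟪cascadeWavelet ε₀ (𝒟.ψ i) n, modeL hε₀ 𝒟 i n (V s)⟫_ℂ).re + (driveC 𝒟 α u i n s).re) -
      2 * A * Ec s ≤ 0
    rw [hEc_eq]
    nlinarith
  have hanti : Antitone Φ := antitone_of_deriv_nonpos (fun r => (hΦd r).differentiableAt) hΦ'
  have hΦ0 : Φ 0 = 0 := by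
    simp only [hΦ, intervalIntegral.integral_same, mul_zero, sub_zero]
    rw [hEcdef, hXcdef, modeEc_zero hε₀, modeXc_zero hε₀]
    split_ifs <;> norm_num
  have hΦt : Φ t ≤ 0 := hΦ0 ▸ hanti ht
  -- back to `E`, `X`
  have hint : ∫ s in (0 : ℝ)..t, modeEnergy 𝒟 u i n s = ∫ s in (0 : ℝ)..t, Ec s := by
    refine intervalIntegral.integral_congr fun s hs => ?_
    rw [uIcc_of_le ht] at hs
    exact hu.modeEnergy_eq_Ec hε₀ hs.1
  have h2A : 8 * Real.pi ^ 2 * (1 + ε₀ / 2) ^ 2 * (1 + ε₀) ^ ((2 : ℝ) * n) = 2 * A := by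
    rw [hA, laplaceBound_eq hε₀]
    ring
  rw [hu.modeEnergy_eq_Ec hε₀ ht, hu.modeCoeff_eq_re hε₀ ht, hint, h2A]
  have key : Ec t - (1 / 2) * (Xc t).re ^ 2 - 2 * A * ∫ r in (0 : ℝ)..t, Ec r ≤ 0 := hΦt
  change Ec t ≤ 1 / 2 * (Xc t).re ^ 2 + 2 * A * ∫ s in (0 : ℝ)..t, Ec s
  linarith

/-! ### (4.6)–(4.7): a priori bounds -/

/-- **A uniform bound for the coefficients and projections on `[0,T]`** ((4.6)–(4.7)): there is
`C ≥ 0` with `‖u(t)‖_{H¹⁰} ≤ C` on `[0,T]`, hence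
`(1 + (1+ε₀)^{10n}) ‖u_{i,n}(t)‖ ≤ 2C` and `(1 + (1+ε₀)^{10n}) |X_{i,n}(t)| ≤ 2C`. [cite: Tao2016AveragedNS, §4 (4.6)–(4.7)] -/
theorem IsMildSolutionFor.exists_apriori (T : ℝ) :
    ∃ C : ℝ, 0 ≤ C ∧ ∀ t ∈ Icc 0 T, ∀ (i : Fin m) (n : ℤ),
      (1 + (1 + ε₀) ^ ((10 : ℝ) * n)) * ‖modeProjection 𝒟 i n (u t)‖ ≤ 2 * C ∧
      (1 + (1 + ε₀) ^ ((10 : ℝ) * n)) * |modeCoeff 𝒟 u i n t| ≤ 2 * C := by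
  obtain ⟨C, hC0, hC⟩ := hu.2.1.exists_forall_Icc_le (fun t ht => (hu.1 t ht).1) T
  refine ⟨C, hC0, fun t ht i n => ?_⟩
  have hP := one_add_mul_norm_modeProjection_le 𝒟 (one_add_pos_of_pos hε₀) i n hC0 (hC t ht)
  rw [← rpow_ten_mul_intCast hε₀] at hP
  refine ⟨hP, le_trans ?_ hP⟩
  refine mul_le_mul_of_nonneg_left ?_ (by positivity)
  -- `|X| ≤ ‖u_{i,n}‖`
  rw [modeCoeff, pairing_eq_inner (isReal_cascadeWavelet ε₀ (𝒟.ψ i) n),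
    ← inner_modeProjection_eq_of_isBandLimited 𝒟 i n (cascadeWavelet_isBandLimited (one_add_pos_of_pos hε₀) 𝒟 i n)]
  refine (Complex.abs_re_le_norm _).trans ((norm_inner_le_norm _ _).trans ?_)
  rw [𝒟.norm_cascadeWavelet (one_add_pos_of_pos hε₀), one_mul]

/-! ### (4.13): no very low frequencies -/

/-- **(4.13)**: `E_{i,n}(t) = 0` and `X_{i,n}(t) = 0` for `n < n₀`, `t ≥ 0` (the ODE-layer
Gronwall lemma `TaoCascade.lowMode_energy_eq_zero` fed with (4.11), (4.12), (4.8)–(4.9) and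
(4.6)). [cite: Tao2016AveragedNS, Lemma 4.1 (4.13)] -/
theorem IsMildSolutionFor.noLow (i : Fin m) (n : ℤ) (hn : n < n₀) {t : ℝ} (ht : 0 ≤ t) :
    modeEnergy 𝒟 u i n t = 0 ∧ modeCoeff 𝒟 u i n t = 0 := by
  obtain ⟨C, hC0, hC⟩ := hu.exists_apriori hε₀ t
  have hcont : ∀ j k, ContinuousOn (modeEnergy 𝒟 u j k) (Icc 0 t) := fun j k =>
    (hu.contDiffOn_modeEnergy hε₀ j k).continuousOn.mono Icc_subset_Ici_self
  have hderiv : ∀ j k, ∀ s ∈ Ico 0 t, HasDerivWithinAt (modeEnergy 𝒟 u j k)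
      (modeEc' hε₀ 𝒟 α i₀ n₀ u j k s) (Ici s) s := fun j k s hs =>
    (hu.hasDerivWithinAt_modeEnergy hε₀ j k hs.1).mono (Ici_subset_Ici.2 hs.1)
  have henergy : ∀ j k, ∀ s ∈ Ico 0 t, modeEc' hε₀ 𝒟 α i₀ n₀ u j k s ≤
      TaoCascade.quadTerm ε₀ α (modeCoeff 𝒟 u) j k s * modeCoeff 𝒟 u j k s := by
    intro j k s hs
    have h := hu.energy hε₀ j k hs.1
    rwa [(hu.hasDerivWithinAt_modeEnergy hε₀ j k hs.1).derivWithin (uniqueDiffOn_Ici 0 s hs.1)] at h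
  have hlower : ∀ j k, ∀ s ∈ Icc 0 t, (1 / 2) * modeCoeff 𝒟 u j k s ^ 2 ≤ modeEnergy 𝒟 u j k s :=
    fun j k s hs => hu.defect_lower hε₀ j k hs.1
  have hnonneg : ∀ j k s, 0 ≤ modeEnergy 𝒟 u j k s := fun j k s => modeEnergy_nonneg 𝒟 u j k s
  have hinit : ∀ j k, k < n₀ → modeEnergy 𝒟 u j k 0 = 0 := by
    intro j k hk
    rw [hu.init_E hε₀, hu.init_X hε₀, if_neg (fun h => hk.ne h.2)]
    norm_num
  have hbound : ∀ j k, ∀ s ∈ Icc 0 t, |modeCoeff 𝒟 u j k s| ≤ 2 * C := by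
    intro j k s hs
    have h := (hC s hs j k).2
    have hq : 0 ≤ (1 + ε₀) ^ ((10 : ℝ) * k) := by positivity
    nlinarith [abs_nonneg (modeCoeff 𝒟 u j k s)]
  have hE := TaoCascade.lowMode_energy_eq_zero hε₀ α n₀ (modeCoeff 𝒟 u) (modeEnergy 𝒟 u)
    (modeEc' hε₀ 𝒟 α i₀ n₀ u) hcont hderiv henergy hlower hnonneg hinit (by positivity) hbound i n hn t
    ⟨ht, le_rfl⟩
  refine ⟨hE, ?_⟩
  have h := hlower i n t ⟨ht, le_rfl⟩
  rw [hE] at h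
  nlinarith [sq_nonneg (modeCoeff 𝒟 u i n t)]

end Mode

/-! ### Lemma 4.1 -/

/-- **Tao 2016, Lemma 4.1 (Equations of motion) — an independent proof of the named fact
`equationsOfMotion`** (first discharged by `equationsOfMotion_holds`, `TaoCascadeEquationsOfMotion.lean`).
For `0 < ε₀ < 1`, wavelet data `𝒟`, structure constants `α`, and every
global mild solution `u : [0,∞) → H¹⁰_df` of `∂ₜu = Δu + C(u,u)`, `u(0) = ψ_{i₀,n₀}`, the coefficients
`X_{i,n} = Re⟨u, ψ_{i,n}⟩` and energies `E_{i,n} = ½‖u_{i,n}‖²` obey (4.6)–(4.13)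
(`TaoCascade.CascadeODESolution`) with the implied constants `K₁ = 4√2π²(1+ε₀/2)²`,
`K₂ = 8π²(1+ε₀/2)²` depending on `ε₀` only. [cite: Tao2016AveragedNS, Lemma 4.1] -/
theorem equationsOfMotion_of_bandDuhamel : equationsOfMotion := by
  intro ε₀ hε₀ _ m 𝒟 α _ _
  refine ⟨4 * Real.pi ^ 2 * (1 + ε₀ / 2) ^ 2 * Real.sqrt 2, 8 * Real.pi ^ 2 * (1 + ε₀ / 2) ^ 2,
    by positivity, by positivity, fun i₀ n₀ u hu => ?_⟩
  exact
    { contDiffOn_X := fun i n => hu.contDiffOn_modeCoeff hε₀ i n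
      contDiffOn_E := fun i n => hu.contDiffOn_modeEnergy hε₀ i n
      nonneg_E := fun i n t _ => modeEnergy_nonneg 𝒟 u i n t
      apriori_X := fun T _ => by
        obtain ⟨C, _, hC⟩ := hu.exists_apriori hε₀ T
        exact ⟨2 * C, fun t ht i n => (hC t ht i n).2⟩
      apriori_E := fun T _ => by
        obtain ⟨C, hC0, hC⟩ := hu.exists_apriori hε₀ T
        refine ⟨2 * C, fun t ht i n => le_trans ?_ (hC t ht i n).1⟩
        refine mul_le_mul_of_nonneg_left ?_ (by positivity)
        rw [modeEnergy, sqrt_sq_div_two (norm_nonneg _)]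
        exact div_le_self (norm_nonneg _) (Real.one_le_sqrt.2 (by norm_num))
      init_E := fun i n => hu.init_E hε₀ i n
      init_X := fun i n => hu.init_X hε₀ i n
      motion := fun i n t ht => hu.motion hε₀ i n ht
      energy := fun i n t ht => hu.energy hε₀ i n ht
      defect_lower := fun i n t ht => hu.defect_lower hε₀ i n ht
      defect_upper := fun i n t ht => hu.defect_upper hε₀ i n ht
      noLow_X := fun i n t hn ht => (hu.noLow hε₀ i n hn ht).2
      noLow_E := fun i n t hn ht => (hu.noLow hε₀ i n hn ht).1 }

end Literature.Analysis.FluidPDE.Tao2016
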